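import Summits.ResolutionOfSingularities.ResolutionOfSingularities.Theorems.FrobeniusClosingPatchingRelPerfectDepthPhaseCCarrierCountdownStep
import Summits.ResolutionOfSingularities.ResolutionOfSingularities.Theorems.FrobeniusClosingPatchingRelPerfectDepthMultiHostResidual
import Summits.ResolutionOfSingularities.ResolutionOfSingularities.Theorems.FrobeniusClosingPatchingRelPerfectDepthMultiHostEnd
import Literature.AlgebraicGeometry.Resolution.BlowupSequencesAppend
import Literature.AlgebraicGeometry.Resolution.SigmaMaxEliminationInDim
import HarnessLib

/-!
# Crux `PatchingRelPerfect` (stmt-ResolutionOfSingularities-16161), chain W5.2 — F7(β) d = 2 (β-AX), C-I finish (CE2):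
# THE CARRIER COUNTDOWN — `K♭` becomes the unit ideal, hence the `PhaseCOne` conclusion

[OURS · L1 W5.2 · res-L1-w52-lead-1 g6 (res-L1-w52-plan-1 NOTE G11-38 (3) / G11-40 (CE2), TAKING 18:02Z; v1 = BOUNDARY components)]
Replaces the role of NO printed item; NOT a statement of the manuscript under review; fact-free.

* `countdown` — induction on the total exponent of the trace `J = K|_G = monomialIdeal 𝓛` over the one-step theorem `countdown_step`
  (…DepthPhaseCCarrierCountdownStep): finitely many blowings up of `X` in regular centres (double curves `G ∩ E`) over `cosupp K`, regular top,
  `K𝒪_top = M · K_top` with `M` effective Cartier (the accumulated exceptional monomial) and `K_top = ⊤` for the stepped state.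
* `isEndOn_top_of_K_eq_top` — a state with `K = ⊤` is at ideal-level END on `U := ⊤` (`𝓕 := []`, `𝒦 := [[]]`).
* `phaseCOne_conclusion_of_carrier` — THE `PhaseCOne` CONCLUSION (RULING G11-36, typed in `ChainW52F7BetaR.PhaseCOne`) for a state `S₁`
  whose RESIDUAL state carries a carrier `G ≤ S₁.residual.K` as above: apply `countdown` to `S := S₁.residual`, multiply back the member-wise
  minimal monomial (`K_eq_monomial_mul_residual`, A8), and read END off `K_top = ⊤`.
* `phaseCOne_conclusion_of_isEffectiveCartier` — THE END GLUE of RULING G11-51 (2) ((G-end) unit state + (G-mb) multiply-back): the same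
  conclusion from ANY principalisation of the residual over its cosupport with regular centres and regular top — the currency in which CE1
  (`…DepthPhaseCCarrierGameLift`, res-D-pv-046) delivers; CE2's countdown is one instance (RULING G11-53: banked, counted 0).
The hypotheses are the C-I END CURRENCY of record at a pole component (G11-47 (2) / A20 «`J` monomial on `G` in boundary components»):
free (non-boundary) components are C-I's burden (G11-36 (5)); the one-blow-up pre-phase turning a free component into the trace of a
new member, and CE1 (`…CarrierGameLift`, the T4 lift producing this input from an ideal-level END on `G`), are sibling modules.

AI-written; AI review is weaker than expert review.

## References
* J. Kollár, *Lectures on Resolution of Singularities* (2007), (3.111) Steps 1–3. [Kollar2007]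
* U. Görtz, T. Wedhorn, *Algebraic Geometry I* (2nd ed. 2020), Prop. 13.91, (13.19). [GortzWedhorn2020]
* E. Bierstone, D. Grigoriev, P. Milman, J. Włodarczyk, arXiv:1206.3090, §4 Remark (3). [BierstoneGrigorievMilmanWlodarczyk2011]
-/

-- `Summit.<Summit>.<Sub>.Theorems` with `Sub = Summit` (single-conjunct summit, D-0017)
set_option linter.dupNamespace false

noncomputable section

open CategoryTheory AlgebraicGeometry TopologicalSpace IsLocalRing
open Literature.AlgebraicGeometry.Resolution
open Scheme.IdealSheafData

namespace Summit.ResolutionOfSingularities.ResolutionOfSingularities.Theorems.DepthMultiHost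

universe u

namespace MultiHostState

variable {X : Scheme.{u}}

/-! ## §1 Bookkeeping -/

/-- An exponent list with all exponents zero gives the unit ideal. [folklore] -/
theorem monomialIdeal_eq_top_of_forall_snd_eq_zero {Y : Scheme.{u}} :
    ∀ (L : List (Y.IdealSheafData × ℕ)), (∀ p ∈ L, p.2 = 0) → monomialIdeal L = ⊤
  | [], _ => monomialIdeal_nil
  | p :: L, h => by
    rw [monomialIdeal_cons, h p List.mem_cons_self, pow_zero, one_mul]
    exact monomialIdeal_eq_top_of_forall_snd_eq_zero L fun q hq => h q (List.mem_cons_of_mem _ hq)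

/-- An open subscheme of a regular scheme is regular. [folklore] -/
theorem isRegular_opens (hX : Scheme.IsRegular X) (U : X.Opens) : Scheme.IsRegular (U : Scheme.{u}) := by
  intro x
  haveI := hX (U.ι x)
  exact IsRegularLocalRing.of_ringEquiv (asIso (U.ι.stalkMap x)).commRingCatIsoToRingEquiv

/-- [OURS · L1 W5.2] **A state with `K = ⊤` is at ideal-level END on `U := ⊤`** (`𝓕 := []`, `𝒦 := [[]]`: `monomialSum [[]] = ⊤`).
[cite: Kollar2007, (3.111) Step 3] -/
theorem isEndOn_top_of_K_eq_top [IsLocallyNoetherian X] (hX : Scheme.IsRegular X) (S : MultiHostState X) (hK : S.K = ⊤) :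
    S.IsEndOn ⊤ := by
  refine ⟨[], [[]], fun L hL => ?_, List.cons_ne_nil _ _, ?_, ?_, ?_⟩
  · rw [List.mem_singleton] at hL; subst hL; rfl
  · rw [List.map_nil]
    haveI : IsLocallyNoetherian ((⊤ : X.Opens) : Scheme.{u}) := LocallyOfFiniteType.isLocallyNoetherian (⊤ : X.Opens).ι
    exact hasSNC_nil_of_isRegular (isRegular_opens hX ⊤)
  · rw [hK, Scheme.IdealSheafData.support_top]; exact fun _ h => absurd h (by simp)
  · rw [hK, DepthTargets.monomialSum_singleton, monomialIdeal_nil]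

/-- `K = ⊤` forces `K♭ = ⊤`. [folklore] -/
theorem residual_K_eq_top_of_K_eq_top (S : MultiHostState X) (hK : S.K = ⊤) : S.residual.K = ⊤ :=
  top_le_iff.mp (hK ▸ S.K_le_residual_K)

/-! ## §2 The countdown -/

/-- [OURS · L1 W5.2] **THE CARRIER COUNTDOWN.** `X` regular Noetherian, `S` a multi-host state, `G ≤ S.K` an integral carrier (regular
hypersurface, effective Cartier, snc with the members), the trace `S.K|_G = monomialIdeal 𝓛` a monomial in prime divisor ideals of
codimension-one points of `V(G)`, every codimension-one point of its cosupport on a member whose germ there differs from `G`'s: then finitely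
many blowings up in regular centres over `cosupp S.K` with regular top transform `S.K` into `M · K_top` with `M` effective Cartier and
`K_top = ⊤` the ideal of a state with as many summands. [cite: Kollar2007, (3.111) Steps 1–3] [cite: GortzWedhorn2020, Prop. 13.91] -/
theorem countdown : ∀ (N : ℕ) {X : Scheme.{u}} [IsNoetherian X] (_ : Scheme.IsRegular X) (S : MultiHostState X) {G : X.IdealSheafData}
    (_ : G ≤ S.K)
    (_ : ∀ x ∈ G.support, ∃ v : X.presheaf.stalk x, stalkIdeal G x = Ideal.span {v} ∧ v ∉ (maximalIdeal (X.presheaf.stalk x)) ^ 2)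
    (_ : IsEffectiveCartier G) [IsIntegral G.subscheme] (_ : HasSNC (G :: S.𝓔))
    (_ : ∀ ξ : G.subscheme, Order.coheight ξ = 1 → ξ ∈ (S.K.comap G.subschemeι).support →
      ∃ E ∈ S.𝓔, ¬ stalkIdeal E (G.subschemeι ξ) ≤ stalkIdeal G (G.subschemeι ξ) ∧ G.subschemeι ξ ∈ E.support)
    (𝓛 : List (G.subscheme.IdealSheafData × ℕ)) (_ : S.K.comap G.subschemeι = monomialIdeal 𝓛)
    (_ : ∀ p ∈ 𝓛, 0 < p.2 → ∃ ξ : G.subscheme, Order.coheight ξ = 1 ∧ p.1 = primeDivisorIdeal ξ)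
    (_ : (𝓛.map Prod.snd).sum = N),
    ∃ s : CentreSeq X, s.AllRegular ∧ s.CentresOver (S.K.support : Set X) ∧ Scheme.IsRegular s.top ∧
      ∃ (_ : IsNoetherian s.top) (M : s.top.IdealSheafData) (S' : MultiHostState s.top),
        S.K.comap s.comp = M * S'.K ∧ IsEffectiveCartier M ∧ S'.n = S.n ∧ S'.K = ⊤ := by
  intro N
  induction N with
  | zero =>
    intro X _ hX S G hGK hGhyp hGc _ hsnc hcov 𝓛 hJ h𝓛 hN
    -- all exponents vanish: `J = ⊤`, hence `K = ⊤`; the empty sequence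
    have h0 : ∀ p ∈ 𝓛, p.2 = 0 := by
      intro p hp
      have := List.sum_eq_zero_iff.mp hN p.2 (List.mem_map.mpr ⟨p, hp, rfl⟩)
      exact this
    have hK : S.K = ⊤ := eq_top_of_comap_subschemeι_eq_top hGK (by rw [hJ, monomialIdeal_eq_top_of_forall_snd_eq_zero 𝓛 h0])
    refine ⟨CentreSeq.nil X, trivial, trivial, hX, ‹IsNoetherian X›, ⊤, S, ?_, isEffectiveCartier_top, rfl, hK⟩
    show S.K.comap (𝟙 X) = ⊤ * S.K
    rw [Scheme.IdealSheafData.comap_id, ← Scheme.IdealSheafData.one_eq_top, one_mul]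
  | succ N ih =>
    intro X _ hX S G hGK hGhyp hGc _ hsnc hcov 𝓛 hJ h𝓛 hN
    -- an entry with positive exponent, split off
    have hpos : ∃ p ∈ 𝓛, 0 < p.2 := by
      by_contra hall
      have h0 : (𝓛.map Prod.snd).sum = 0 := List.sum_eq_zero_iff.mpr fun n hn => by
        obtain ⟨p, hp, rfl⟩ := List.mem_map.mp hn
        exact Nat.eq_zero_of_not_pos fun h => hall ⟨p, hp, h⟩
      omega
    obtain ⟨p, hp, hp0⟩ := hpos
    obtain ⟨𝓛₁, 𝓛₂, h𝓛eq⟩ := List.append_of_mem hp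
    obtain ⟨ζ, hζ, hpζ⟩ := h𝓛 p hp hp0
    obtain ⟨a, ha⟩ := Nat.exists_eq_succ_of_ne_zero hp0.ne'
    have hpeq : p = (primeDivisorIdeal ζ, a + 1) := Prod.ext hpζ ha
    rw [hpeq] at h𝓛eq
    subst h𝓛eq
    -- one step
    obtain ⟨hCreg, hCsupp, hN', S', G', hG'int, 𝓛', hX', hK, hn, hsupp', hG'K, hG'hyp, hG'c, hsnc', hcov', hJ', hsum, h𝓛'⟩ :=
      countdown_step hX S hGK hGhyp hGc hsnc hcov 𝓛₁ 𝓛₂ hζ a hJ h𝓛 ⟨closure {G.subschemeι ζ}, isClosed_closure⟩ rfl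
    haveI := hN'
    haveI := hG'int
    -- recurse
    have hN'' : (𝓛'.map Prod.snd).sum = N := by omega
    obtain ⟨s', hs'reg, hs'over, hs'top, hNtop, M', S'', hK', hM', hn', hK''⟩ :=
      ih hX' S' hG'K hG'hyp hG'c hsnc' hcov' 𝓛' hJ' h𝓛' hN''
    refine ⟨CentreSeq.cons _ s', ⟨hCreg, hs'reg⟩, ⟨hCsupp, hs'over.mono _ hsupp'⟩, hs'top, hNtop,
      (((vanishingIdeal (⟨closure {G.subschemeι ζ}, isClosed_closure⟩ : Closeds X)).comap (blowup.π _)).comap s'.comp) * M', S'', ?_,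
      ((blowup.isBlowup _).isEffectiveCartier.comap_centreSeqComp s').mul hM', by rw [hn', hn], hK''⟩
    show S.K.comap (s'.comp ≫ blowup.π _) = _
    rw [Scheme.IdealSheafData.comap_comp, hK, comap_mul, hK']
    exact (mul_assoc _ _ _).symm

/-! ## §3 The `PhaseCOne` conclusion -/

/-- [OURS · L1 W5.2] **CE2: CARRIER COUNTDOWN ⇒ THE `PhaseCOne` CONCLUSION.** For a state `S₁` with a summand on regular Noetherian `X`
whose RESIDUAL state `S₁♭ = S₁.residual` carries a carrier `G ≤ S₁♭.K` (integral regular hypersurface snc with the members) on which the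
residual trace is a monomial in BOUNDARY components (codimension-one points on members with a germ different from `G`'s): finitely many
blowings up in regular centres over `cosupp S₁.K`, with regular top, factor `S₁.K𝒪 = M · S₂.K` with `M` effective Cartier and `S₂` a state
with a summand whose residual is at ideal-level END (indeed `S₂.K = ⊤`). [cite: Kollar2007, (3.111) Steps 1–3] [cite: GortzWedhorn2020, Prop. 13.91] -/
theorem phaseCOne_conclusion_of_carrier [IsNoetherian X] (hX : Scheme.IsRegular X) (S₁ : MultiHostState X) (hn : S₁.n ≠ 0)
    {G : X.IdealSheafData} (hGK : G ≤ S₁.residual.K)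
    (hGhyp : ∀ x ∈ G.support, ∃ v : X.presheaf.stalk x, stalkIdeal G x = Ideal.span {v} ∧ v ∉ (maximalIdeal (X.presheaf.stalk x)) ^ 2)
    (hGc : IsEffectiveCartier G) [IsIntegral G.subscheme] (hsnc : HasSNC (G :: S₁.𝓔))
    (hcov : ∀ ξ : G.subscheme, Order.coheight ξ = 1 → ξ ∈ (S₁.residual.K.comap G.subschemeι).support →
      ∃ E ∈ S₁.𝓔, ¬ stalkIdeal E (G.subschemeι ξ) ≤ stalkIdeal G (G.subschemeι ξ) ∧ G.subschemeι ξ ∈ E.support)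
    (𝓛 : List (G.subscheme.IdealSheafData × ℕ)) (hJ : S₁.residual.K.comap G.subschemeι = monomialIdeal 𝓛)
    (h𝓛 : ∀ p ∈ 𝓛, 0 < p.2 → ∃ ξ : G.subscheme, Order.coheight ξ = 1 ∧ p.1 = primeDivisorIdeal ξ) :
    ∃ (s : CentreSeq X), s.AllRegular ∧ s.CentresOver (S₁.K.support : Set X) ∧ Scheme.IsRegular s.top ∧
      ∃ (_ : IsNoetherian s.top) (M : s.top.IdealSheafData) (S₂ : MultiHostState s.top),
        S₁.K.comap s.comp = M * S₂.K ∧ IsEffectiveCartier M ∧ S₂.n ≠ 0 ∧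
        ∃ (U : s.top.Opens), S₂.residual.IsEndOn U := by
  obtain ⟨s, hsreg, hsover, hstop, hNtop, M, S₂, hK, hM, hn₂, hK₂⟩ :=
    countdown _ hX S₁.residual hGK hGhyp hGc (by rw [S₁.residual_𝓔]; exact hsnc)
      (by rw [S₁.residual_𝓔]; exact hcov) 𝓛 hJ h𝓛 rfl
  haveI := hNtop
  refine ⟨s, hsreg, hsover.mono _ S₁.residual_K_support_subset, hstop, hNtop,
    (monomialIdeal S₁.minExps).comap s.comp * M, S₂, ?_, (S₁.isEffectiveCartier_monomialIdeal_minExps.comap_centreSeqComp s).mul hM,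
    by rw [hn₂, S₁.residual_n]; exact hn, ⊤, isEndOn_top_of_K_eq_top hstop S₂.residual (S₂.residual_K_eq_top_of_K_eq_top hK₂)⟩
  conv_lhs => rw [S₁.K_eq_monomial_mul_residual]
  rw [comap_mul, hK, mul_assoc]

/-! ## §4 The END GLUE for the lifted carrier game (RULING G11-51 (2): (G-end) unit state + (G-mb) multiply-back) -/

/-- [OURS · L1 W5.2] **END GLUE (G11-51 (2) (G-end) + (G-mb)).** If a sequence `t` of blowings up in regular centres over `cosupp K♭`
with regular top PRINCIPALISES the residual `K♭ = S₁.residual.K` (CE1 `carrierGameLift`'s conclusion: `IsEffectiveCartier (K♭.comap t.comp)`),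
then the `PhaseCOne` conclusion holds for `S₁`: `S₁.K𝒪 = (M₀𝒪 · K♭𝒪) · ⊤` with the UNIT STATE (no members, hosts `⊤`, as many summands)
whose residual is at END on `⊤`. [cite: Kollar2007, (3.111) Step 3] -/
theorem phaseCOne_conclusion_of_isEffectiveCartier [IsNoetherian X] (S₁ : MultiHostState X) (hn : S₁.n ≠ 0)
    (t : CentreSeq X) (htreg : t.AllRegular) (htover : t.CentresOver (S₁.residual.K.support : Set X)) (httop : Scheme.IsRegular t.top)
    (hE : IsEffectiveCartier (S₁.residual.K.comap t.comp)) :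
    ∃ (s : CentreSeq X), s.AllRegular ∧ s.CentresOver (S₁.K.support : Set X) ∧ Scheme.IsRegular s.top ∧
      ∃ (_ : IsNoetherian s.top) (M : s.top.IdealSheafData) (S₂ : MultiHostState s.top),
        S₁.K.comap s.comp = M * S₂.K ∧ IsEffectiveCartier M ∧ S₂.n ≠ 0 ∧
        ∃ (U : s.top.Opens), S₂.residual.IsEndOn U := by
  haveI : IsNoetherian t.top := CentreSeq.isNoetherian_top t
  let S₂ : MultiHostState t.top :=
    { 𝓔 := [], n := S₁.n, host := fun _ => ⊤, exps := fun _ => [], snc := hasSNC_nil_of_isRegular httop,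
      boundaryOf_exps := fun _ => rfl }
  have hK₂ : S₂.K = ⊤ := by
    haveI : Nonempty (Fin S₁.n) := ⟨⟨0, Nat.pos_of_ne_zero hn⟩⟩
    show (⨆ _ : Fin S₁.n, (⊤ : t.top.IdealSheafData) * monomialIdeal []) = ⊤
    rw [monomialIdeal_nil, ← Scheme.IdealSheafData.one_eq_top, mul_one, iSup_const]
  refine ⟨t, htreg, htover.mono _ S₁.residual_K_support_subset, httop, ‹_›,
    (monomialIdeal S₁.minExps).comap t.comp * S₁.residual.K.comap t.comp, S₂, ?_,
    (S₁.isEffectiveCartier_monomialIdeal_minExps.comap_centreSeqComp t).mul hE, hn, ⊤,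
    isEndOn_top_of_K_eq_top httop S₂.residual (S₂.residual_K_eq_top_of_K_eq_top hK₂)⟩
  rw [hK₂, ← Scheme.IdealSheafData.one_eq_top, mul_one]
  conv_lhs => rw [S₁.K_eq_monomial_mul_residual]
  rw [comap_mul]

end MultiHostState

end Summit.ResolutionOfSingularities.ResolutionOfSingularities.Theorems.DepthMultiHost

end
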